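/-
Copyright (c) 2026 the pub-hodgecm-mathlib formalisation cell (harness21).  Prover seat hodgecm-mathlib-K2E4-p14 (g9), Track B ∕ K2-LIT, h413 = `stmt-HodgeConjecture-24833`,
line `K2_E1_TraceFormulaBeta`, campaign 5Res (ROADCARD §3′ M2 v2), deals (246)∕(248) of the dealer K2E1-plan (g7) («bracket bridge «=», your census = the spec»): FILE B1 — the
χ-Maass–Selberg relation of `U(1,1)∕CM` in RAW bracket currency, transported to the Gram pairing of the operator road's truncated `L²` families (the χ-twin of ★
`exists_fourTerm_tube_cm_two` :146 ∘ the `hraw` step of ★ `normSq_family_eq_fourTerm_on'`).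
-/
import Summits.HodgeConjecture.HodgeConjecture.Theorems.K2E1ChiMaassSelbergCMTwo    -- ★ p859665 (K2E1-p14): `maassSelberg_chiSection_cm_two_self` (raw χ-MS relation, survivor `hdec′`)
import HarnessLib

/-!
# K2·E1 — `K2E1ChiMaassSelbergPairingFamilyCMTwo` (5Res, bracket bridge FILE B1): `⟪F′ z′, F z⟫ = R_χ(z, z′)` IN RAW BRACKETS for the truncated `L²` families of a self-dual
# `χ`-family of `U(1,1)_{L∕L⁺}` on the sub-tube `1 < Re z′ < Re z`

Track B ∕ K2-LIT, crux h413 = `stmt-HodgeConjecture-24833`, route of record `HCCMUnconditional`; cell `hodgecm-mathlib`, squad K2, ENGINE E1 (5Res, the (d)-realness ∕ `hs` road at M1).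
THEOREMS ONLY (no `def`, no `instance`, no notation, no named-fact hypothesis, no `sorry`); lane `--supports stmt-HodgeConjecture-24833 --as helper` (count-neutral).  Closes no socket.

WHAT.  ★ `K2E1ChiMaassSelbergCMTwo.maassSelberg_chiSection_cm_two_self` (K2E1-p14, p859665) is the χ-Maass–Selberg relation for ONE unitary normalised Hecke character `χ` and two
continuous bounded `χ`-sections `φ, φ′`: the raw pairing `∫ Λ^T E(f_z^φ)·conj Λ^T E(f′_{z′}^{φ′}) dμ` on the sub-tube `1 < Re z′ < Re z` equals `cμ·K·(four-term)` with brackets = idele-class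
integrals of `‖x‖·(χ-pair density)·(K_U-pairing)`, ALL `hΞᵢ` discharged, survivor `hdec′` (the decay of `E(f′_{z′}) − E_B(f′_{z′})` above height `T`; payer at M1: K2E4-p10 (b) per (248),
★ `K2E1HeightLineArchSmoothU2` :233).  THIS FILE transports it to the operator road: for `L²(𝔛, μ)`-valued families `F, F′` on a set `D₁` agreeing a.e. with the truncated series on the
tube (★ closer₂-χ `exists_truncatedFamily_chi_cm_two` :209 supplies them), `⟪F′ z′, F z⟫ = cμ·K·(the same four-term)` for `z, z′ ∈ D₁` on the sub-tube — the `hrel` letter of ★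
`K2E1ChiMaassSelbergContinuedCMTwo.poleControl_continued_chi_cm_two_of_family_on` ∕ `…OnBoxes…` ∕ `…Lower…` in RAW bracket currency (FILE B2 = the model currency
`κ·m·⟪·,·⟫_V` at M1, K2E1-p13 lineage).  Proof = Mathlib `L2.inner_def` + the two a.e. identities + ★ :232.
* HEAD **`inner_truncatedFamily_eq_fourTerm_chi_cm_two`** — binders: ★ :232's structural measures; `hβ hT`; `χ` unitary, `ρ`-normalised; `φ, φ′` continuous bounded `χ`-sections;
  `hdec′ : ∀ z′, 1 < Re z′ → ∃ M₁, …` (visible letter); `D₁`, `F`, `F′` with the tube identities ⟹ `∃ cμ K > 0, ∀ z z′ ∈ D₁, 1 < Re z′ < Re z → ⟪F′ z′, F z⟫ = cμ·K·(four-term)`.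
HONEST LABEL: HC_CM is proved only modulo the 7 printed citations (2 remaining named inputs: hLiu418 = `stmt-HodgeConjecture-24832`, h413 = `stmt-HodgeConjecture-24833`) until rung 0
closes; this file asserts no named fact and closes no socket; count-neutral; CONDITIONAL on `hdec′` (visible) and on the families it is fed.

## References
* [MoeglinWaldspurger1995] C. Mœglin, J.-L. Waldspurger, *Spectral decomposition and Eisenstein series* (1995), II.1.7, IV.2.3, IV.3.12 (a).
* [Arthur1980TraceFormulaII] J. Arthur, *A trace formula for reductive groups II*, Compositio Math. 40 (1980), §4.
* [BernsteinLapid2019] J. Bernstein, E. Lapid, *On the meromorphic continuation of Eisenstein series*, J. AMS 37 (2024), §4.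
-/

set_option autoImplicit false
-- the mandated namespace repeats `HodgeConjecture.HodgeConjecture`, as in every `Theorems/*.lean` of this sub-problem
set_option linter.dupNamespace false

noncomputable section

open MeasureTheory MeasureTheory.Measure Set NumberField IsDedekindDomain Filter Topology Metric
open scoped NNReal ENNReal ComplexConjugate InnerProductSpace
open Literature.MeasureTheory.Group Literature.NumberTheory
open Literature.NumberTheory.Automorphic Literature.NumberTheory.Automorphic.UnitaryGroup AdelicGroupData
open Literature.NumberTheory.GaloisRepresentations
open Summit.HodgeConjecture.HodgeConjecture.Cruxes.H413.K2E1BorelEisensteinU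
open Summit.HodgeConjecture.HodgeConjecture.Cruxes.H413.K2E1CharacterEisensteinU2Defs
open Summit.HodgeConjecture.HodgeConjecture.Cruxes.H413.K2E1ChiMaassSelbergCMTwo (maassSelberg_chiSection_cm_two_self)

namespace Summit.HodgeConjecture.HodgeConjecture.Cruxes.H413.K2E1ChiMaassSelbergPairingFamilyCMTwo

variable (L : Type) [Field L] [NumberField L] [IsCMField L]
variable [MeasurableSpace (quasiSplit (↥(maximalRealSubfield L)) L (IsCMField.complexConj L) 2).Adelic] [BorelSpace (quasiSplit (↥(maximalRealSubfield L)) L (IsCMField.complexConj L) 2).Adelic]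
variable [MeasurableSpace (AdeleRing (𝓞 L) L)ˣ] [BorelSpace (AdeleRing (𝓞 L) L)ˣ]

/-- **`⟪F′ z′, F z⟫ = cμ·K·R_χ(z, z′)` IN RAW BRACKETS ON THE SUB-TUBE** for `L²(𝔛, μ)`-valued families `F, F′` on `D₁` agreeing a.e. with `Λ^T E(f_z^φ)`, `Λ^T E(f′_{z′}^{φ′})` on the tube
(`φ, φ′` continuous bounded `χ`-sections, `χ` unitary and `ρ`-normalised): ★ `maassSelberg_chiSection_cm_two_self` VERBATIM on the right, Mathlib `L2.inner_def` + the two a.e.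
identities on the left; survivor `hdec′` visible (per `z′`).  The `hrel` letter of ★ `poleControl_continued_chi_cm_two_of_family_on` in raw bracket currency.
[cite: MoeglinWaldspurger1995, II.1.7 and IV.2.3] [cite: Arthur1980TraceFormulaII, §4] [cite: BernsteinLapid2019, §4] -/
theorem inner_truncatedFamily_eq_fourTerm_chi_cm_two
    (μ : Measure (quasiSplit (↥(maximalRealSubfield L)) L (IsCMField.complexConj L) 2).automorphicQuotient) [(quasiSplit (↥(maximalRealSubfield L)) L (IsCMField.complexConj L) 2).IsAutomorphicMeasure μ]
    (νG : Measure (quasiSplit (↥(maximalRealSubfield L)) L (IsCMField.complexConj L) 2).Adelic) [νG.IsHaarMeasure] [νG.IsInvInvariant]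
    (μK : Measure ((standardMaximalCompactGL 2 L).comap (adelicVal (↥(maximalRealSubfield L)) L (IsCMField.complexConj L) 2 ((StdForm.antidiagonal 2).over L)) : Subgroup (quasiSplit (↥(maximalRealSubfield L)) L (IsCMField.complexConj L) 2).Adelic))
    [μK.IsHaarMeasure]
    (νI : Measure (AdeleRing (𝓞 L) L)ˣ) [νI.IsHaarMeasure]
    {𝓕I : Set (AdeleRing (𝓞 L) L)ˣ} (h𝓕I : IsIdeleClassDomain L 𝓕I)
    (ν : Measure ↥(adelicUnipotent (↥(maximalRealSubfield L)) L (IsCMField.complexConj L) 2)) [ν.IsHaarMeasure]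
    {𝓕 : Set ↥(adelicUnipotent (↥(maximalRealSubfield L)) L (IsCMField.complexConj L) 2)} (h𝓕N : IsFundamentalDomain ↥(rationalUnipotent (↥(maximalRealSubfield L)) L (IsCMField.complexConj L) 2) 𝓕 ν) (h𝓕1 : ν 𝓕 = 1)
    (h𝓕c : IsCompact (closure 𝓕))
    {β : (quasiSplit (↥(maximalRealSubfield L)) L (IsCMField.complexConj L) 2).Adelic → ℝ≥0∞} (hβ : IsCoveringWeight ((arithmeticBorel (↥(maximalRealSubfield L)) L (IsCMField.complexConj L) 2).map (quasiSplit (↥(maximalRealSubfield L)) L (IsCMField.complexConj L) 2).arithmeticSubgroup.subtype) β)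
    {T : ℝ≥0} (hT : 1 ≤ T)
    {χ : HeckeCharacter L} (hχ : χ.IsUnitary) (hρ : ∀ r : ℝ≥0ˣ, χ (posRealIdele L r) = 1)
    {φ φ' : (quasiSplit (↥(maximalRealSubfield L)) L (IsCMField.complexConj L) 2).Adelic → ℂ}
    (hφc : Continuous φ) (hφ : IsChiSection χ φ) {Cφ : ℝ} (hφC : ∀ x, ‖φ x‖ ≤ Cφ)
    (hφ'c : Continuous φ') (hφ' : IsChiSection χ φ') {Cφ' : ℝ} (hφ'C : ∀ x, ‖φ' x‖ ≤ Cφ')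
    -- the survivor `hdec′` of ★ :232, at every point of the tube (payer at M1: K2E4-p10 (b), ★ `K2E1HeightLineArchSmoothU2` :233)
    (hdec' : ∀ z' : ℂ, 1 < z'.re → ∃ M₁ : ℝ, ∀ g : (quasiSplit (↥(maximalRealSubfield L)) L (IsCMField.complexConj L) 2).Adelic, T < borelHeight g →
      ‖eisensteinSeriesU (flatSectionU φ' z') g - borelConstantTerm ν 𝓕 (eisensteinSeriesU (flatSectionU φ' z')) g‖ ≤ M₁)
    -- the operator road's families on `D₁` with their tube identities (★ closer₂-χ)
    {D₁ : Set ℂ} (F F' : ℂ → Lp ℂ 2 μ)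
    (hFtube : ∀ z ∈ D₁, 1 < z.re → ((F z : Lp ℂ 2 μ) : (quasiSplit (↥(maximalRealSubfield L)) L (IsCMField.complexConj L) 2).automorphicQuotient → ℂ) =ᵐ[μ] (quasiSplit (↥(maximalRealSubfield L)) L (IsCMField.complexConj L) 2).quotFun (truncation ν 𝓕 T (eisensteinSeriesU (flatSectionU φ z))))
    (hF'tube : ∀ z' ∈ D₁, 1 < z'.re → ((F' z' : Lp ℂ 2 μ) : (quasiSplit (↥(maximalRealSubfield L)) L (IsCMField.complexConj L) 2).automorphicQuotient → ℂ) =ᵐ[μ] (quasiSplit (↥(maximalRealSubfield L)) L (IsCMField.complexConj L) 2).quotFun (truncation ν 𝓕 T (eisensteinSeriesU (flatSectionU φ' z')))) :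
    ∃ cμ K : ℝ, 0 < cμ ∧ 0 < K ∧ ∀ z ∈ D₁, ∀ z' ∈ D₁, 1 < z'.re → z'.re < z.re → ⟪F' z', F z⟫_ℂ =
          (cμ : ℂ) * ((K : ℂ) *
            ((((T : ℝ) : ℂ) ^ (z + conj z' - 1) / (z + conj z' - 1)) * ((∫ x in {x : (AdeleRing (𝓞 L) L)ˣ | (IdeleClassGroup.ideleNorm L x : ℝ) ≤ 1} ∩ 𝓕I, ((IdeleClassGroup.ideleNorm L x : ℝ) : ℂ) ∂νI) *
                  (∫ k, φ (k : (quasiSplit (↥(maximalRealSubfield L)) L (IsCMField.complexConj L) 2).Adelic) * conj (φ' (k : (quasiSplit (↥(maximalRealSubfield L)) L (IsCMField.complexConj L) 2).Adelic)) ∂μK))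
              + (((T : ℝ) : ℂ) ^ (z - conj z') / (z - conj z')) * (∫ x in {x : (AdeleRing (𝓞 L) L)ˣ | (IdeleClassGroup.ideleNorm L x : ℝ) ≤ 1} ∩ 𝓕I, ((IdeleClassGroup.ideleNorm L x : ℝ) : ℂ) * (((χ x : ℂˣ) : ℂ) * conj ((reflectChar (IsCMField.complexConj L) χ x : ℂˣ) : ℂ) *
                  (∫ k, φ (k : (quasiSplit (↥(maximalRealSubfield L)) L (IsCMField.complexConj L) 2).Adelic) * conj ((fun g : (quasiSplit (↥(maximalRealSubfield L)) L (IsCMField.complexConj L) 2).Adelic => (∫ v : ↥(adelicUnipotent (↥(maximalRealSubfield L)) L (IsCMField.complexConj L) 2), flatSectionU φ' z' ((quasiSplit (↥(maximalRealSubfield L)) L (IsCMField.complexConj L) 2).toAdelic (weylLongU ((IsCMField.complexConj L : L ≃ₐ[↥(maximalRealSubfield L)] L) : L →+* L) (rfl : (StdForm.antidiagonal 2).over L = (StdForm.antidiagonal 2).over L)) * ((v : (quasiSplit (↥(maximalRealSubfield L)) L (IsCMField.complexConj L) 2).Adelic) * g)) ∂ν) * ((borelHeight g : ℝ) : ℂ)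 ^ (z' - 1)) (k : (quasiSplit (↥(maximalRealSubfield L)) L (IsCMField.complexConj L) 2).Adelic)) ∂μK)) ∂νI)
              - (((T : ℝ) : ℂ) ^ (-(z - conj z')) / (z - conj z')) * (∫ x in {x : (AdeleRing (𝓞 L) L)ˣ | (IdeleClassGroup.ideleNorm L x : ℝ) ≤ 1} ∩ 𝓕I, ((IdeleClassGroup.ideleNorm L x : ℝ) : ℂ) * (((reflectChar (IsCMField.complexConj L) χ x : ℂˣ) : ℂ) * conj ((χ x : ℂˣ) : ℂ) *
                  (∫ k, (fun g : (quasiSplit (↥(maximalRealSubfield L)) L (IsCMField.complexConj L) 2).Adelic => (∫ v : ↥(adelicUnipotent (↥(maximalRealSubfield L)) L (IsCMField.complexConj L) 2), flatSectionU φ z ((quasiSplit (↥(maximalRealSubfield L)) L (IsCMField.complexConj L) 2).toAdelic (weylLongU ((IsCMField.complexConj L : L ≃ₐ[↥(maximalRealSubfield L)] L) : L →+* L) (rfl : (StdForm.antidiagonal 2).over L = (StdForm.antidiagonal 2).over L)) * ((v : (quasiSplit (↥(maximalRealSubfield L)) L (IsCMField.complexConj L) 2).Adelic) * g)) ∂ν)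 * ((borelHeight g : ℝ) : ℂ) ^ (z - 1)) (k : (quasiSplit (↥(maximalRealSubfield L)) L (IsCMField.complexConj L) 2).Adelic) * conj (φ' (k : (quasiSplit (↥(maximalRealSubfield L)) L (IsCMField.complexConj L) 2).Adelic)) ∂μK)) ∂νI)
              - (((T : ℝ) : ℂ) ^ (-(z + conj z' - 1)) / (z + conj z' - 1)) * ((∫ x in {x : (AdeleRing (𝓞 L) L)ˣ | (IdeleClassGroup.ideleNorm L x : ℝ) ≤ 1} ∩ 𝓕I, ((IdeleClassGroup.ideleNorm L x : ℝ) : ℂ) ∂νI) *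
                  (∫ k, (fun g : (quasiSplit (↥(maximalRealSubfield L)) L (IsCMField.complexConj L) 2).Adelic => (∫ v : ↥(adelicUnipotent (↥(maximalRealSubfield L)) L (IsCMField.complexConj L) 2), flatSectionU φ z ((quasiSplit (↥(maximalRealSubfield L)) L (IsCMField.complexConj L) 2).toAdelic (weylLongU ((IsCMField.complexConj L : L ≃ₐ[↥(maximalRealSubfield L)] L) : L →+* L) (rfl : (StdForm.antidiagonal 2).over L = (StdForm.antidiagonal 2).over L)) * ((v : (quasiSplit (↥(maximalRealSubfield L)) L (IsCMField.complexConj L) 2).Adelic) * g)) ∂ν) * ((borelHeight g : ℝ) : ℂ) ^ (z - 1)) (k : (quasiSplit (↥(maximalRealSubfield L)) L (IsCMField.complexConj L) 2).Adelic) * conj ((fun g : (quasiSplit (↥(maximalRealSubfield L)) L (IsCMField.complexConj L) 2).Adelic => (∫ v : ↥(adelicUnipotent (↥(maximalRealSubfield L)) L (IsCMField.complexConj L) 2), flatSectionU φ' z' ((quasiSplit (↥(maximalRealSubfield L)) L (IsCMField.complexConj L) 2).toAdelic (weylLongU ((IsCMField.complexConj L : L ≃ₐ[↥(maximalRealSubfield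 L)] L) : L →+* L) (rfl : (StdForm.antidiagonal 2).over L = (StdForm.antidiagonal 2).over L)) * ((v : (quasiSplit (↥(maximalRealSubfield L)) L (IsCMField.complexConj L) 2).Adelic) * g)) ∂ν) * ((borelHeight g : ℝ) : ℂ) ^ (z' - 1)) (k : (quasiSplit (↥(maximalRealSubfield L)) L (IsCMField.complexConj L) 2).Adelic)) ∂μK)))) := by
  obtain ⟨cμ, K, hcμ, hK, h⟩ := maassSelberg_chiSection_cm_two_self L μ νG μK νI h𝓕I ν h𝓕N h𝓕1 h𝓕c
  refine ⟨cμ, K, hcμ, hK, fun z hz z' hz' h1 h2 => ?_⟩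
  obtain ⟨M₁, hM₁⟩ := hdec' z' h1
  have hraw : ⟪F' z', F z⟫_ℂ = ∫ x, (quasiSplit (↥(maximalRealSubfield L)) L (IsCMField.complexConj L) 2).quotFun (truncation ν 𝓕 T (eisensteinSeriesU (flatSectionU φ z))) x * conj ((quasiSplit (↥(maximalRealSubfield L)) L (IsCMField.complexConj L) 2).quotFun (truncation ν 𝓕 T (eisensteinSeriesU (flatSectionU φ' z'))) x) ∂μ := by
    rw [MeasureTheory.L2.inner_def]
    refine integral_congr_ae ?_
    filter_upwards [hFtube z hz (h1.trans h2), hF'tube z' hz' h1] with x hx hx'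
    rw [hx, hx', RCLike.inner_apply, mul_comm]
  rw [hraw]
  exact h hβ hT hχ hρ hφc hφ hφC hφ'c hφ' hφ'C h1 h2 hM₁

end Summit.HodgeConjecture.HodgeConjecture.Cruxes.H413.K2E1ChiMaassSelbergPairingFamilyCMTwo

end
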